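import Summits.AnomalousDissipation.AnomalousDissipation.Theorems.TaylorCertificatesForcedStandingFlowsStep
import Literature.Analysis.FluidPDE.ConvexIntegration2DIteration
import HarnessLib

/-!
# Route SteadyWeakLimit — support `StandingCascadeExists`: the forced convex-integration iteration

Helper file for the item `stmt-AnomalousDissipation-1309` (`StandingCascadeExists`: a bounded
weak STATIONARY Euler flow on `T³` driven by a smooth steady force absorbing positive power). The
tree proves the unforced `h`-principle of Choffrut–Székelyhidi 2014, Thm. 1
(`Literature.Analysis.FluidPDE.StationaryEuler.*`) by the explicit iteration `IterData` of
`StationaryEulerIteration.lean`, run inside the space `X₀` of smooth strict HOMOGENEOUS weak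
subsolutions. The forced problem `div (v ⊗ v) + ∇p = f` relaxes to the AFFINE linear system
`div v = 0`, `div u + ∇q = f`; since every increment of the iteration is a weak subsolution of the
homogeneous system (`IsTorusSub`), the affine identities are those of the base field `w₀` and are
preserved along the run. This file is the tree's `StationaryEulerIteration.lean` verbatim with

* `MemX0` replaced by the affine version `MemX 𝓕 e w₀ w` (`w` smooth, `w - w₀` a homogeneous weak
  subsolution, `w(x) ∈ 𝒰_{e(x)}`), the step being `ForcedFlows.step'`
  (`TaylorCertificatesForcedStandingFlowsStep.lean`, the tree's step under the hypotheses it uses);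
* one extra continuous test field `t` to which every increment is `ε_k`-orthogonal (used with
  `t = (f, 0)` to keep the power `∫ ⟪f, v_k⟫` within `θ` of `∫ ⟪f, v₀⟫`), and the exact vanishing
  of the coordinate means of the increments;
* the `H⁻¹` bookkeeping dropped.

Conclusions as in the tree: uniform bounds, the `L²` Cauchy property (`cauchy`), summable defects
(`tendsto_J`). The limit is taken in `SteadyWeakLimitStandingCascadeExistsLimit.lean`.

## References

* A. Choffrut, L. Székelyhidi Jr., *Weak solutions to the stationary incompressible Euler
  equations*, SIAM J. Math. Anal. 46 (2014) 4060–4074 = arXiv:1401.4301, §2, Step 3.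
* L. Székelyhidi Jr., *From isometric embeddings to turbulence*, Lecture notes (2012), §5–6.
-/

noncomputable section

open scoped InnerProductSpace ContDiff ENNReal Topology
open Set Function MeasureTheory Metric Filter
open Literature.Analysis.FunctionSpaces Literature.Analysis.FluidPDE
open Literature.Analysis.FluidPDE.StationaryEuler

namespace Summit.AnomalousDissipation.AnomalousDissipation.Theorems

-- the mandated namespace `Summit.<Summit>.<Problem>.Theorems` repeats `AnomalousDissipation` (single-problem summit)
set_option linter.dupNamespace false

namespace StandingCascade

variable {d : Type*} [Fintype d] [DecidableEq d]

/-! ## The affine space `X₀` -/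

/-- **`w` in the affine `X₀` based at `w₀`**: `w` is smooth, `w - w₀` is a weak subsolution of the
HOMOGENEOUS linear system (so `w` satisfies the same affine identities as `w₀`), and
`w(x) ∈ 𝒰_{e(x)}` for every `x`. [cite: ChoffrutSzekelyhidi2014, §2, Step 1] -/
structure MemX (𝓕 : RelaxedFamily d) (e : UnitAddTorus d → ℝ) (w₀ w : UnitAddTorus d → State d) : Prop where
  /-- smoothness -/
  smooth : Torus.IsSmooth w
  /-- the homogeneous weak subsolution identities of `w - w₀` -/
  sub : IsTorusSub fun x => w x - w₀ x
  /-- strictness: values in the relaxed sets -/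
  mem : ∀ x, w x ∈ 𝓕.U (e x)

namespace MemX

variable {𝓕 : RelaxedFamily d} {e : UnitAddTorus d → ℝ} {w₀ w : UnitAddTorus d → State d}

/-- Values of affine-`X₀` fields lie in `𝒦^{co}_{e(x)}`. [folklore] -/
theorem mem_C (h : MemX 𝓕 e w₀ w) (x : UnitAddTorus d) : w x ∈ C (e x) := 𝓕.subset_C _ (h.mem x)

variable [Nonempty d]

/-- `|v(x)|² ≤ e(x)` on the affine `X₀`. [folklore] -/
theorem norm_vel_sq_le (h : MemX 𝓕 e w₀ w) (x : UnitAddTorus d) : ‖vel (w x)‖ ^ 2 ≤ e x :=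
  norm_vel_sq_le_of_mem_C (h.mem_C x)

/-- The energy profile is non-negative along the affine `X₀`. [folklore] -/
theorem nonneg (h : MemX 𝓕 e w₀ w) (x : UnitAddTorus d) : 0 ≤ e x := nonneg_of_mem_C (h.mem_C x)

/-- **Uniform bound**: `‖w(x)‖ ≤ √ē + 3 ē d` if `e ≤ ē`. [cite: ChoffrutSzekelyhidi2014, §2, Step 1] -/
theorem norm_le (h : MemX 𝓕 e w₀ w) {ebar : ℝ} (he : ∀ x, e x ≤ ebar) (x : UnitAddTorus d) :
    ‖w x‖ ≤ Real.sqrt ebar + 3 * ebar * Fintype.card d := by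
  have h1 := norm_le_of_mem_C (h.mem_C x)
  have h0 := h.nonneg x
  calc ‖w x‖ ≤ Real.sqrt (e x) + 3 * e x * Fintype.card d := h1
    _ ≤ Real.sqrt ebar + 3 * ebar * Fintype.card d := by
        gcongr
        · exact he x
        · exact he x

/-- The defect is non-negative on the affine `X₀`. [folklore] -/
theorem defect_nonneg (h : MemX 𝓕 e w₀ w) : 0 ≤ defect e w :=
  integral_nonneg fun x => sub_nonneg.2 (h.norm_vel_sq_le x)

end MemX

variable [Nonempty d]

/-! ## The data of a forced run -/

/-- The fixed data of one run of the forced iteration: the relaxed family, the (continuous) energy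
profile `e`, the smooth strict base field `w₀` (an affine subsolution: its linear identities are
NOT required to be homogeneous), a continuous test field `t`, and the tolerance `θ > 0`.
[cite: ChoffrutSzekelyhidi2014, §2] -/
structure FIterData (d : Type*) [Fintype d] [DecidableEq d] [Nonempty d] where
  /-- the relaxed sets -/
  𝓕 : RelaxedFamily d
  /-- the energy profile -/
  e : UnitAddTorus d → ℝ
  /-- the base field -/
  w₀ : UnitAddTorus d → State d
  /-- the extra test field -/
  t : UnitAddTorus d → State d
  /-- the tolerance -/
  θ : ℝ
  he : Continuous e
  hw₀ : Torus.IsSmooth w₀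
  hw₀U : ∀ x, w₀ x ∈ 𝓕.U (e x)
  ht : Continuous t
  hθ : 0 < θ

namespace FIterData

variable (D : FIterData d)

/-- The base field lies in its own affine `X₀`. [folklore] -/
theorem memX_w₀ : MemX D.𝓕 D.e D.w₀ D.w₀ where
  smooth := D.hw₀
  sub := by simpa only [sub_self] using (isTorusSub_zero (d := d))
  mem := D.hw₀U

/-- The tolerance at stage `k`: `ε_k = θ 2^{-(k+1)}`. [folklore] -/
def eps (k : ℕ) : ℝ := D.θ / 2 ^ (k + 1)

/-- The tolerances are positive. [folklore] -/
theorem eps_pos (k : ℕ) : 0 < D.eps k := by unfold eps; have := D.hθ; positivity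

/-- The tolerances are non-negative. [folklore] -/
theorem eps_nonneg (k : ℕ) : 0 ≤ D.eps k := (D.eps_pos k).le

/-- The tolerances form a geometric sequence. [folklore] -/
theorem eps_eq (k : ℕ) : D.eps k = D.θ / 2 * (1 / 2) ^ k := by
  rw [eps, one_div, inv_pow, pow_succ]; ring

/-- The tolerances are summable. [folklore] -/
theorem summable_eps : Summable D.eps := by
  rw [show D.eps = fun k => D.θ / 2 * (1 / 2) ^ k from funext D.eps_eq]
  exact (summable_geometric_of_lt_one (by norm_num) (by norm_num)).mul_left _

/-- `∑ ε_k = θ`. [folklore] -/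
theorem tsum_eps : ∑' k, D.eps k = D.θ := by
  rw [show D.eps = fun k => D.θ / 2 * (1 / 2) ^ k from funext D.eps_eq, tsum_mul_left,
    tsum_geometric_of_lt_one (by norm_num) (by norm_num)]
  ring

/-- Partial sums of the tolerances are at most `θ`. [folklore] -/
theorem sum_eps_le (s : Finset ℕ) : ∑ k ∈ s, D.eps k ≤ D.θ := by
  rw [← D.tsum_eps]; exact D.summable_eps.sum_le_tsum s fun k _ => D.eps_nonneg k

/-- Partial sums of the tolerances are below `θ`. [folklore] -/
theorem sum_range_eps_lt (n : ℕ) : ∑ k ∈ Finset.range n, D.eps k < D.θ := by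
  have h : ∑ k ∈ Finset.range (n + 1), D.eps k ≤ D.θ := D.sum_eps_le _
  rw [Finset.sum_range_succ] at h
  linarith [D.eps_pos n]

/-! ## The iteration -/

/-- An admissible history: all entries in `X₀`. [folklore] -/
def HistOK (k : ℕ) (H : Fin (k + 1) → UnitAddTorus d → State d) : Prop := ∀ j, MemX D.𝓕 D.e D.w₀ (H j)

/-- The specification of the increment at stage `k` (an instance of `ForcedFlows.step'`, with the previous
states and the fixed field `t` as test fields). [cite: ChoffrutSzekelyhidi2014, §2, Step 3] -/
theorem step_spec (k : ℕ) (H : {H : Fin (k + 1) → UnitAddTorus d → State d // D.HistOK k H}) :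
    ∃ W : UnitAddTorus d → State d, Torus.IsSmooth W ∧ IsTorusSub W ∧
      (∀ x, H.1 (Fin.last k) x + W x ∈ D.𝓕.U (D.e x)) ∧
      (∀ j, |∫ x, ⟪W x, H.1 j x⟫_ℝ| ≤ D.eps k) ∧ |∫ x, ⟪W x, D.t x⟫_ℝ| ≤ D.eps k ∧
      (∀ c, ∫ x, W x c = 0) ∧
      defect D.e (H.1 (Fin.last k)) - D.eps k ≤ ∫ x, ‖W x‖ ^ 2 := by
  have hp : ∀ a, Continuous (Fin.snoc (α := fun _ => UnitAddTorus d → State d) H.1 D.t a) := by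
    intro a
    refine Fin.lastCases ?_ (fun i => ?_) a
    · rw [Fin.snoc_last]; exact D.ht
    · rw [Fin.snoc_castSucc]; exact (H.2 i).smooth.continuous
  obtain ⟨W, hW, hsub, hmem, horth, hmean, hgain⟩ := ForcedFlows.step' D.𝓕 D.he (H.2 (Fin.last k)).smooth
    (fun x => (H.2 (Fin.last k)).mem x) (Fin.snoc (α := fun _ => UnitAddTorus d → State d) H.1 D.t) hp (D.eps_pos k)
  refine ⟨W, hW, hsub, hmem, fun j => ?_, ?_, hmean, hgain⟩
  · have h := horth j.castSucc
    rwa [Fin.snoc_castSucc] at h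
  · have h := horth (Fin.last (k + 1))
    rwa [Fin.snoc_last] at h

/-- **The iteration** (history form). [cite: ChoffrutSzekelyhidi2014, §2, Step 3] -/
def seqAux : (k : ℕ) → {H : Fin (k + 1) → UnitAddTorus d → State d // D.HistOK k H}
  | 0 => ⟨fun _ => D.w₀, fun _ => D.memX_w₀⟩
  | k + 1 =>
    ⟨Fin.snoc (α := fun _ => UnitAddTorus d → State d) (seqAux k).1
        (fun x => (seqAux k).1 (Fin.last k) x + Classical.choose (D.step_spec k (seqAux k)) x), by
      intro j
      refine Fin.lastCases ?_ (fun i => ?_) j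
      · rw [Fin.snoc_last]
        have hs := Classical.choose_spec (D.step_spec k (seqAux k))
        have hH := (seqAux k).2 (Fin.last k)
        refine ⟨hH.smooth.add hs.1, ?_, hs.2.2.1⟩
        have heq : (fun x => (seqAux k).1 (Fin.last k) x + Classical.choose (D.step_spec k (seqAux k)) x - D.w₀ x) =
            fun x => ((seqAux k).1 (Fin.last k) x - D.w₀ x) + Classical.choose (D.step_spec k (seqAux k)) x :=
          funext fun x => by abel
        rw [heq]
        exact hH.sub.add (hH.smooth.sub D.hw₀) hs.1 hs.2.1
      · rw [Fin.snoc_castSucc]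
        exact (seqAux k).2 i⟩

/-- The `k`-th state `w_k`. [folklore] -/
def state (k : ℕ) : UnitAddTorus d → State d := (D.seqAux k).1 (Fin.last k)

/-- The `k`-th increment `W_k`. [folklore] -/
def incr (k : ℕ) : UnitAddTorus d → State d := Classical.choose (D.step_spec k (D.seqAux k))

/-- `w_0 = w₀`. [folklore] -/
theorem state_zero : D.state 0 = D.w₀ := rfl

/-- `w_{k+1} = w_k + W_k`. [folklore] -/
theorem state_succ (k : ℕ) : D.state (k + 1) = fun x => D.state k x + D.incr k x := by
  show (D.seqAux (k + 1)).1 (Fin.last (k + 1)) = _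
  simp only [seqAux, Fin.snoc_last]
  rfl

/-- `w_{k+1}(x) = w_k(x) + W_k(x)`. [folklore] -/
theorem state_succ_apply (k : ℕ) (x : UnitAddTorus d) : D.state (k + 1) x = D.state k x + D.incr k x := by
  rw [D.state_succ]

/-- Earlier entries of the history are the earlier states. [folklore] -/
theorem seqAux_castSucc (k : ℕ) (j : Fin (k + 1)) : (D.seqAux (k + 1)).1 j.castSucc = (D.seqAux k).1 j := by
  show Fin.snoc (α := fun _ => UnitAddTorus d → State d) (D.seqAux k).1 _ j.castSucc = _
  rw [Fin.snoc_castSucc]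

/-- The history consists of the states. [folklore] -/
theorem seqAux_eq_state (k : ℕ) (j : Fin (k + 1)) : (D.seqAux k).1 j = D.state j := by
  induction k with
  | zero => fin_cases j; rfl
  | succ k ih =>
    refine Fin.lastCases ?_ (fun i => ?_) j
    · rfl
    · rw [D.seqAux_castSucc k i, ih i]; rfl

/-- **All states lie in the affine `X₀`.** [cite: ChoffrutSzekelyhidi2014, §2, Step 3] -/
theorem state_memX (k : ℕ) : MemX D.𝓕 D.e D.w₀ (D.state k) := (D.seqAux k).2 (Fin.last k)

/-- The increments are smooth. [folklore] -/
theorem incr_smooth (k : ℕ) : Torus.IsSmooth (D.incr k) := (Classical.choose_spec (D.step_spec k (D.seqAux k))).1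

/-- **Near-orthogonality of the increments to all previous states.** [folklore] -/
theorem incr_orth_state {k j : ℕ} (hj : j ≤ k) : |∫ x, ⟪D.incr k x, D.state j x⟫_ℝ| ≤ D.eps k := by
  have h := (Classical.choose_spec (D.step_spec k (D.seqAux k))).2.2.2.1 ⟨j, Nat.lt_succ_of_le hj⟩
  simp only [D.seqAux_eq_state] at h
  exact h

/-- **Near-orthogonality of the increments to the fixed test field `t`.** [folklore] -/
theorem incr_orth_t (k : ℕ) : |∫ x, ⟪D.incr k x, D.t x⟫_ℝ| ≤ D.eps k :=
  (Classical.choose_spec (D.step_spec k (D.seqAux k))).2.2.2.2.1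

/-- **The coordinate means of the increments vanish.** [folklore] -/
theorem integral_incr_apply (k : ℕ) (c : Idx d) : ∫ x, D.incr k x c = 0 :=
  (Classical.choose_spec (D.step_spec k (D.seqAux k))).2.2.2.2.2.1 c

/-- **The gain of the increments.** [folklore] -/
theorem incr_gain (k : ℕ) : defect D.e (D.state k) - D.eps k ≤ ∫ x, ‖D.incr k x‖ ^ 2 :=
  (Classical.choose_spec (D.step_spec k (D.seqAux k))).2.2.2.2.2.2

/-! ## Bounds and energies -/

/-- The states are continuous. [folklore] -/
theorem state_continuous (k : ℕ) : Continuous (D.state k) := (D.state_memX k).smooth.continuous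

/-- The increments are continuous. [folklore] -/
theorem incr_continuous (k : ℕ) : Continuous (D.incr k) := (D.incr_smooth k).continuous

/-- `W_k = w_{k+1} - w_k`. [folklore] -/
theorem incr_eq_sub (k : ℕ) (x : UnitAddTorus d) : D.incr k x = D.state (k + 1) x - D.state k x := by
  rw [D.state_succ_apply]; abel

/-- The maximum `ē` of the energy profile. [folklore] -/
def ebar : ℝ := ⨆ x, D.e x

/-- `e ≤ ē`. [folklore] -/
theorem e_le_ebar (x : UnitAddTorus d) : D.e x ≤ D.ebar := le_ciSup (isCompact_range D.he).bddAbove x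

/-- The uniform bound `R = √ē + 3 ē d` on all states. [cite: ChoffrutSzekelyhidi2014, §2, Step 1] -/
def R : ℝ := Real.sqrt D.ebar + 3 * D.ebar * Fintype.card d

/-- **All states are bounded by `R`.** [cite: ChoffrutSzekelyhidi2014, §2, Step 1] -/
theorem norm_state_le (k : ℕ) (x : UnitAddTorus d) : ‖D.state k x‖ ≤ D.R := (D.state_memX k).norm_le D.e_le_ebar x

/-- `R ≥ 0`. [folklore] -/
theorem R_nonneg : 0 ≤ D.R := by
  obtain ⟨x⟩ : Nonempty (UnitAddTorus d) := inferInstance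
  exact (norm_nonneg _).trans (D.norm_state_le 0 x)

end FIterData

end StandingCascade

end Summit.AnomalousDissipation.AnomalousDissipation.Theorems
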